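import Mathlib
import Literature.Analysis.Complex.SimilarityRegularisation
import Literature.Analysis.Complex.ApproximateHolomorphy
import HarnessLib

/-!
# The Liouville theorem of the similarity principle

A smooth `f : ℂ → ℂ` with `∂̄ f = r` (`∂̄ = Literature.Analysis.Complex.dbarAlong 1`),
`‖r‖ ≤ M ‖f‖`, `r = 0` where `ρ ≤ ‖z‖`, and `f → 0` at infinity vanishes identically
(`eq_zero_of_dbar_le_of_tendsto_zero`). Classically (Carleman–Bers–Vekua; Vekua's *generalized
analytic functions*; Wendl (2020), App. B Thm B.20; McDuff–Salamon (2012), §2.3) one writes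
`f = e^{s} h` with `h` entire and `s = T (r / f)` bounded and continuous, so that `h = e^{-s} f`
is an entire function tending to `0`, hence `h ≡ 0`. This is the injectivity statement for
linearised Cauchy–Riemann operators `w ↦ ∂̄ w + A w` with compactly supported zeroth-order term on
functions decaying at infinity.

We stay inside `C^∞` with the `δ`-regularisation device of
`Literature/Analysis/Complex/SimilarityRegularisation.lean`: if `f z₀ ≠ 0`, the regularised
coefficient `a = r · conj f / (|f|² + δ)` (`‖a‖ ≤ M`, `‖r - a f‖ ≤ M √δ / 2`) has a Cauchy
transform `s = T a` which is bounded on the WHOLE plane uniformly in `δ`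
(`Similarity.norm_cauchyTransform_le_uniform`: `‖s‖ ≤ 6 ρ M`, from the disc bound on `‖z‖ ≤ 2ρ`
and the elementary far bound `‖(T a)(w)‖ ≤ ρ M` for `‖w‖ ≥ 2ρ`,
`Similarity.norm_cauchyTransform_le_far`). Then `h = e^{-s} f` has `‖∂̄ h‖ ≤ e^{S} M √δ / 2`
everywhere, `‖h‖ ≤ e^{S} ‖f‖` is small on a large circle `‖z‖ = L` and `‖h z₀‖ ≥ e^{-S} ‖f z₀‖`;
Cauchy–Pompeiu with a cut-off (`exists_holomorphic_approx_of_dbar_le`) gives `H` holomorphic on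
`‖z‖ < L + 1` with `‖h - H‖ ≤ C_L e^{S} M √δ / 2` on `‖z‖ ≤ L + 1`, and the maximum modulus
principle for `H` on `‖z‖ ≤ L` bounds `‖h z₀‖` by its values on the circle plus the error; choosing
`δ` small (after `L`) is contradictory. No limit `δ → 0` is needed.

## Contents

* `Similarity.norm_cauchyTransform_le_far`, `Similarity.norm_cauchyTransform_le_uniform`,
  `Similarity.exists_potential_uniform` — the global potential;
* `Similarity.exists_forall_norm_lt_of_tendsto_cocompact` — `f → 0` at infinity in radius form;
* `fst_dbarAlong`, `snd_dbarAlong` — components of `∂̄_v` of a product-valued map (used to split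
  triangular systems into scalar equations);
* `eq_zero_of_dbar_le_of_tendsto_zero` — the theorem.

Provenance: written for the crux `TameOrBrodyR4` of summit `SmoothPoincare4` (injectivity of the
linearised, frame-conjugated Cauchy–Riemann operator along a pencil member).

## References

* C. Wendl, *Lectures on Contact 3-Manifolds, Holomorphic Curves and Intersection Theory* (2020),
  App. B, Thm B.20 (similarity principle). [Wendl2020]
* D. McDuff, D. Salamon, *J-holomorphic curves and symplectic topology*, 2nd ed. (2012), §2.3
  (Carleman similarity principle). [McDuffSalamon2012]
-/

noncomputable section

open scoped ContDiff ComplexConjugate Topology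
open Filter Set Metric MeasureTheory

namespace Literature.Analysis.Complex

/-! ### Components of `∂̄_v` for product-valued maps -/

section Prod

variable {E : Type*} [NormedAddCommGroup E] [NormedSpace ℂ E]
  {F : Type*} [NormedAddCommGroup F] [NormedSpace ℂ F]
  {G : Type*} [NormedAddCommGroup G] [NormedSpace ℂ G]

/-- The first component of `∂̄_v u` for `u : E → F × G` is `∂̄_v` of the first component (at a
point of real differentiability). [folklore] -/
theorem fst_dbarAlong {u : E → F × G} {x : E} (hu : DifferentiableAt ℝ u x) (v : E) :
    (dbarAlong v u x).1 = dbarAlong v (fun y => (u y).1) x := by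
  rw [dbarAlong_apply, dbarAlong_apply, fderiv.fst hu]
  simp

/-- The second component of `∂̄_v u` for `u : E → F × G` is `∂̄_v` of the second component (at a
point of real differentiability). [folklore] -/
theorem snd_dbarAlong {u : E → F × G} {x : E} (hu : DifferentiableAt ℝ u x) (v : E) :
    (dbarAlong v u x).2 = dbarAlong v (fun y => (u y).2) x := by
  rw [dbarAlong_apply, dbarAlong_apply, fderiv.snd hu]
  simp

end Prod

namespace Similarity

/-! ### The potential `s = T a`, bounded on the whole plane -/

/-- **Far bound for the Cauchy transform.** If `‖a‖ ≤ M` and `a` vanishes where `ρ₀ ≤ ‖z‖`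
(`0 < ρ₀`), then `‖(T a)(w)‖ ≤ ρ₀ M` for `‖w‖ ≥ 2ρ₀`: the integrand `(π t)⁻¹ a (w - t)` lives on
the disc `‖t - w‖ < ρ₀`, of area `π ρ₀²`, where `‖t‖ ≥ ρ₀` and so
`‖(π t)⁻¹ a (w - t)‖ ≤ M / (π ρ₀)`. [folklore] -/
theorem norm_cauchyTransform_le_far {a : ℂ → ℂ} {ρ₀ M : ℝ} (hρ₀ : 0 < ρ₀)
    (ha0 : ∀ z : ℂ, ρ₀ ≤ ‖z‖ → a z = 0) (haM : ∀ z, ‖a z‖ ≤ M) {w : ℂ} (hw : 2 * ρ₀ ≤ ‖w‖) :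
    ‖cauchyTransformAlong 1 a w‖ ≤ ρ₀ * M := by
  rw [cauchyTransformAlong_one_apply]
  -- the integrand vanishes off `ball w ρ₀`
  have hzero : ∀ t ∉ ball w ρ₀, ((↑Real.pi * t)⁻¹ : ℂ) • a (w - t) = 0 := by
    intro t ht
    rw [mem_ball, dist_eq_norm, not_lt, norm_sub_rev] at ht
    rw [ha0 (w - t) ht, smul_zero]
  rw [← setIntegral_eq_integral_of_forall_compl_eq_zero hzero]
  have hbound : ∀ t ∈ ball w ρ₀, ‖((↑Real.pi * t)⁻¹ : ℂ) • a (w - t)‖ ≤ Real.pi⁻¹ * ρ₀⁻¹ * M := by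
    intro t ht
    rw [mem_ball, dist_eq_norm] at ht
    have ht' : ρ₀ ≤ ‖t‖ := by
      have := norm_sub_norm_le w t
      rw [norm_sub_rev] at ht
      linarith
    have hM : 0 ≤ M := (norm_nonneg _).trans (haM 0)
    rw [norm_smul, norm_inv, norm_mul, Complex.norm_real, Real.norm_of_nonneg Real.pi_pos.le,
      mul_inv]
    exact mul_le_mul (mul_le_mul_of_nonneg_left (inv_anti₀ hρ₀ ht') (by positivity)) (haM _)
      (norm_nonneg _) (by positivity)
  calc ‖∫ t in ball w ρ₀, ((↑Real.pi * t)⁻¹ : ℂ) • a (w - t)‖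
      ≤ Real.pi⁻¹ * ρ₀⁻¹ * M * volume.real (ball w ρ₀) :=
        norm_setIntegral_le_of_norm_le_const measure_ball_lt_top hbound
    _ = ρ₀ * M := by
        have hvol : volume.real (ball w ρ₀) = ρ₀ ^ 2 * Real.pi := by
          simp [Measure.real, Complex.volume_ball, ENNReal.toReal_mul, hρ₀.le]
        rw [hvol]
        field_simp

/-- **Uniform bound for the Cauchy transform.** If `‖a‖ ≤ M` and `a` vanishes where `ρ₀ ≤ ‖z‖`
(`0 < ρ₀`), then `‖(T a)(w)‖ ≤ 6 ρ₀ M` for EVERY `w` (disc bound `2 (2ρ₀ + ρ₀) M` on `‖w‖ ≤ 2ρ₀`,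
far bound `ρ₀ M` beyond). [folklore] -/
theorem norm_cauchyTransform_le_uniform {a : ℂ → ℂ} {ρ₀ M : ℝ} (hρ₀ : 0 < ρ₀) (hM : 0 ≤ M)
    (ha0 : ∀ z : ℂ, ρ₀ ≤ ‖z‖ → a z = 0) (haM : ∀ z, ‖a z‖ ≤ M) (w : ℂ) :
    ‖cauchyTransformAlong 1 a w‖ ≤ 6 * ρ₀ * M := by
  by_cases hw : ‖w‖ ≤ 2 * ρ₀
  · calc ‖cauchyTransformAlong 1 a w‖ ≤ 2 * (2 * ρ₀ + ρ₀) * M :=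
          norm_cauchyTransform_le_of_bound hρ₀.le (by positivity) hM ha0 haM hw
      _ = 6 * ρ₀ * M := by ring
  · calc ‖cauchyTransformAlong 1 a w‖ ≤ ρ₀ * M :=
          norm_cauchyTransform_le_far hρ₀ ha0 haM (le_of_not_ge hw)
      _ ≤ 6 * ρ₀ * M := by nlinarith

/-- **The global potential.** For a smooth compactly supported density `a` with `‖a‖ ≤ M`
vanishing where `ρ₀ ≤ ‖z‖` (`0 < ρ₀`), the Cauchy transform `s = T a` is smooth, solves
`∂̄ s = a`, and satisfies `‖s‖ ≤ 6 ρ₀ M` on the whole plane. [folklore] -/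
theorem exists_potential_uniform {a : ℂ → ℂ} {ρ₀ M : ℝ} (hρ₀ : 0 < ρ₀) (hM : 0 ≤ M)
    (ha : ContDiff ℝ ∞ a) (hac : HasCompactSupport a) (haM : ∀ z, ‖a z‖ ≤ M)
    (ha0 : ∀ z : ℂ, ρ₀ ≤ ‖z‖ → a z = 0) :
    ∃ s : ℂ → ℂ, ContDiff ℝ ∞ s ∧ (∀ z, dbarAlong 1 s z = a z) ∧
      ∀ z : ℂ, ‖s z‖ ≤ 6 * ρ₀ * M :=
  ⟨cauchyTransformAlong 1 a, contDiff_cauchyTransformAlong ha hac one_ne_zero,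
    dbarAlong_cauchyTransformAlong (ha.of_le (by exact_mod_cast le_top)) hac one_ne_zero,
    fun w => norm_cauchyTransform_le_uniform hρ₀ hM ha0 haM w⟩

/-! ### Decay at infinity in radius form -/

/-- A function on `ℂ` tending to `0` along `cocompact ℂ` is smaller than any `ε > 0` in norm
outside a large disc. [folklore] -/
theorem exists_forall_norm_lt_of_tendsto_cocompact {F : Type*} [SeminormedAddCommGroup F]
    {f : ℂ → F} (hlim : Tendsto f (cocompact ℂ) (𝓝 0)) {ε : ℝ} (hε : 0 < ε) :
    ∃ R : ℝ, ∀ z : ℂ, R ≤ ‖z‖ → ‖f z‖ < ε := by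
  have hev : ∀ᶠ z in cocompact ℂ, ‖f z‖ < ε :=
    (tendsto_zero_iff_norm_tendsto_zero.1 hlim).eventually (eventually_lt_nhds hε)
  rw [← Metric.cobounded_eq_cocompact,
    (Metric.hasBasis_cobounded_compl_closedBall (0 : ℂ)).eventually_iff] at hev
  obtain ⟨R, -, hR⟩ := hev
  refine ⟨R + 1, fun z hz => hR ?_⟩
  rw [mem_compl_iff, mem_closedBall_zero_iff, not_le]
  linarith

/-! ### The contradiction -/

/-- **Core of the Liouville theorem.** Under the hypotheses of `eq_zero_of_dbar_le_of_tendsto_zero`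
with `0 ≤ M` and `0 < ρ₀`, a point `z₀` with `f z₀ ≠ 0` is contradictory. With `S = 6 ρ₀ M`,
`κ = e^{-S} ‖f z₀‖ > 0`, a radius `L > ‖z₀‖` beyond which `‖f‖ < e^{-S} κ / 4`, the constant `C`
of `exists_holomorphic_approx_of_dbar_le` for the radii `L + 1 < L + 2`, `A = C e^{S} M` and
`δ = t²` with `A t < κ / 4`: the regularised coefficient `a` and its global potential `s`
(`‖s‖ ≤ S` everywhere) give `h = e^{-s} f` with `‖∂̄ h‖ ≤ e^{S} M t / 2`, hence `H` holomorphic on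
`‖z‖ < L + 1` with `‖h - H‖ ≤ A t / 2` on `‖z‖ ≤ L + 1`; on the circle `‖z‖ = L`,
`‖H‖ ≤ ‖h‖ + A t / 2 ≤ κ / 4 + A t / 2`, so by the maximum modulus principle
`κ ≤ ‖h z₀‖ ≤ ‖H z₀‖ + A t / 2 ≤ κ / 4 + A t < κ / 2`. [folklore] -/
theorem false_of_ne_zero_of_tendsto_zero {f r : ℂ → ℂ} {M ρ₀ : ℝ} (hM0 : 0 ≤ M) (hρ₀ : 0 < ρ₀)
    (hf : ContDiff ℝ ∞ f) (hr : ContDiff ℝ ∞ r) (hdbar : ∀ z, dbarAlong (1 : ℂ) f z = r z)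
    (hM : ∀ z, ‖r z‖ ≤ M * ‖f z‖) (hsupp : ∀ z, ρ₀ ≤ ‖z‖ → r z = 0)
    (hlim : Tendsto f (cocompact ℂ) (𝓝 0)) {z₀ : ℂ} (hz₀ : f z₀ ≠ 0) : False := by
  -- sizes: `S` bounds all potentials, `κ = e^{-S} ‖f z₀‖`
  set S : ℝ := 6 * ρ₀ * M with hS_def
  set κ : ℝ := Real.exp (-S) * ‖f z₀‖ with hκ_def
  have hκ : 0 < κ := mul_pos (Real.exp_pos _) (norm_pos_iff.2 hz₀)
  -- the radius `L`: `‖f‖ < e^{-S} κ / 4` where `L ≤ ‖z‖`, and `‖z₀‖ < L`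
  obtain ⟨L₀, hL₀⟩ := exists_forall_norm_lt_of_tendsto_cocompact hlim
    (by positivity : 0 < Real.exp (-S) * κ / 4)
  set L : ℝ := max L₀ (‖z₀‖ + 1) with hL_def
  have hL0 : 0 < L := lt_of_lt_of_le (by positivity) (le_max_right _ _)
  have hz₀L : ‖z₀‖ < L := lt_of_lt_of_le (lt_add_one _) (le_max_right _ _)
  have hfarL : ∀ z : ℂ, ‖z‖ = L → ‖f z‖ < Real.exp (-S) * κ / 4 := fun z hz =>
    hL₀ z (hz ▸ le_max_left _ _)
  -- the constant of approximate holomorphy for the radii `L + 1 < L + 2`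
  obtain ⟨C, hC0, hC⟩ :=
    exists_holomorphic_approx_of_dbar_le (L + 1) (L + 2) (by linarith) (by linarith)
  set A : ℝ := C * Real.exp S * M with hA_def
  have hA0 : 0 ≤ A := by positivity
  -- the regularisation parameter `δ = t²`, chosen with `A t < κ / 4`
  set t : ℝ := κ / (4 * (A + 1)) with ht_def
  have ht0 : 0 < t := by positivity
  have hAt : A * t < κ / 4 := by
    rw [ht_def, mul_div_assoc', div_lt_iff₀ (by positivity)]
    nlinarith
  -- the regularised coefficient
  obtain ⟨ha, hac, haM, har⟩ :=
    regularisedCoefficient f r M ρ₀ (t ^ 2) hM0 (by positivity) hf hr hM hsupp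
  set a : ℂ → ℂ := fun η => r η * conj (f η) / (((‖f η‖ ^ 2 + t ^ 2 : ℝ)) : ℂ) with ha_def
  have ha0 : ∀ η : ℂ, ρ₀ ≤ ‖η‖ → a η = 0 := fun η hη => by simp [ha_def, hsupp η hη]
  have har' : ∀ η, ‖r η - a η * f η‖ ≤ M * t / 2 := fun η => by
    have := har η
    rwa [Real.sqrt_sq ht0.le] at this
  -- the global potential
  obtain ⟨s, hs, hds, hsS⟩ := exists_potential_uniform hρ₀ hM0 ha hac haM ha0
  rw [← hS_def] at hsS
  have hsd : Differentiable ℝ s := hs.differentiable (by simp)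
  have hfd : Differentiable ℝ f := hf.differentiable (by simp)
  -- the modified function `h = e^{-s} f`: small `∂̄`, hence close to a holomorphic `H`
  set h : ℂ → ℂ := fun z => Complex.exp (-s z) * f z with hh_def
  have hh : ContDiff ℝ ∞ h := hs.neg.cexp.mul hf
  have hdh : ∀ z : ℂ, ‖z‖ ≤ L + 2 → ‖dbarAlong 1 h z‖ ≤ Real.exp S * (M * t / 2) := by
    intro z _
    rw [hh_def, dbarAlong_one_exp_neg_mul (hsd z) (hfd z), hdbar z, hds z, norm_mul]
    exact mul_le_mul (norm_exp_neg_le (hsS z)) (har' z) (norm_nonneg _) (Real.exp_pos S).le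
  obtain ⟨H, hH, hHh⟩ := hC h (Real.exp S * (M * t / 2)) hh (by positivity) hdh
  have hCη : C * (Real.exp S * (M * t / 2)) = A * t / 2 := by rw [hA_def]; ring
  -- `‖h‖ ≤ κ / 4` on the circle `‖z‖ = L`, `κ ≤ ‖h z₀‖`
  have hcirc : ∀ z : ℂ, ‖z‖ = L → ‖h z‖ ≤ κ / 4 := fun z hz => by
    have e1 : Real.exp S * (Real.exp (-S) * κ / 4) = κ / 4 := by
      rw [Real.exp_neg]
      field_simp
    calc ‖h z‖ = ‖Complex.exp (-s z)‖ * ‖f z‖ := by rw [hh_def, norm_mul]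
      _ ≤ Real.exp S * (Real.exp (-S) * κ / 4) :=
          mul_le_mul (norm_exp_neg_le (hsS z)) (hfarL z hz).le (norm_nonneg _) (Real.exp_pos S).le
      _ = κ / 4 := e1
  have hlow : κ ≤ ‖h z₀‖ := by
    rw [hh_def, norm_mul]
    exact mul_le_mul_of_nonneg_right (exp_neg_le_norm_exp_neg (hsS z₀)) (norm_nonneg _)
  -- maximum modulus for `H` on `‖z‖ ≤ L`
  have hHz₀ : ‖H z₀‖ ≤ κ / 4 + A * t / 2 := by
    have hd : DiffContOnCl ℂ H (ball 0 L) := by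
      refine DifferentiableOn.diffContOnCl (hH.mono ?_)
      rw [closure_ball 0 hL0.ne']
      exact closedBall_subset_ball (by linarith)
    refine Complex.norm_le_of_forall_mem_frontier_norm_le isBounded_ball hd (fun z hz => ?_) ?_
    · rw [frontier_ball 0 hL0.ne', mem_sphere_zero_iff_norm] at hz
      have h2 := hHh z (by linarith)
      rw [hCη] at h2
      linarith [norm_le_insert (h z) (H z), hcirc z hz]
    · rw [closure_ball 0 hL0.ne']
      exact mem_closedBall_zero_iff.2 hz₀L.le
  -- the contradiction
  have h3 := hHh z₀ (by linarith)
  rw [hCη] at h3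
  linarith [norm_le_insert' (h z₀) (H z₀)]

end Similarity

/-- **The Liouville theorem of the similarity principle.** A smooth `f : ℂ → ℂ` with `∂̄ f = r`
smooth, `‖r‖ ≤ M ‖f‖` pointwise, `r = 0` where `ρ ≤ ‖z‖`, and `f → 0` at infinity, vanishes
identically. (If `f z₀ ≠ 0` then `0 ≤ M`; enlarge `ρ` to `max ρ 1 > 0` and apply
`Similarity.false_of_ne_zero_of_tendsto_zero`.) Classically: `f = e^{s} h` with `s` bounded and
`h` entire tending to `0` (Vekua; Wendl (2020), App. B Thm B.20; McDuff–Salamon (2012), §2.3).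
[folklore] -/
theorem eq_zero_of_dbar_le_of_tendsto_zero (f r : ℂ → ℂ) (M ρ : ℝ) (hf : ContDiff ℝ ∞ f)
    (hr : ContDiff ℝ ∞ r) (hdbar : ∀ z, dbarAlong (1 : ℂ) f z = r z)
    (hM : ∀ z, ‖r z‖ ≤ M * ‖f z‖) (hsupp : ∀ z, ρ ≤ ‖z‖ → r z = 0)
    (hlim : Tendsto f (cocompact ℂ) (𝓝 0)) : f = 0 := by
  by_contra hne
  obtain ⟨z₀, hz₀⟩ := Function.ne_iff.1 hne
  rw [Pi.zero_apply] at hz₀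
  -- `0 ≤ M`, tested at `z₀`
  have hM0 : 0 ≤ M :=
    nonneg_of_mul_nonneg_left ((norm_nonneg _).trans (hM z₀)) (norm_pos_iff.2 hz₀)
  -- a positive support radius
  have hsupp' : ∀ z : ℂ, max ρ 1 ≤ ‖z‖ → r z = 0 := fun z hz =>
    hsupp z ((le_max_left _ _).trans hz)
  exact Similarity.false_of_ne_zero_of_tendsto_zero hM0 (lt_of_lt_of_le one_pos (le_max_right _ _))
    hf hr hdbar hM hsupp' hlim hz₀

end Literature.Analysis.Complex

end
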